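import Literature.AnabelianGeometry.EtaleTheta.Discharge.Sec2ThetaOrbitTransportCalculus
import Literature.AnabelianGeometry.EtaleTheta.ThetaRootOrbitsOfSetting
import HarnessLib

/-!
# [EtTh] Cor 2.8 (i) at the §1 model `ThetaOrbitData.ofEmbedding`: the transport calculus instantiated —
# commutative cyclotome, finite `Dtau`, and conjunct 1 of Cor 2.8 (i) for EVERY induced pair `(Γ, Γ_Θ)`

Mochizuki, *The Étale Theta Function …* [EtTh], Publ. RIMS 45 (2009), §2, Def 2.7 / Cor 2.8 (i), PRIMS PDF
pp.41–42 (bib key `MochizukiEtTh2009`): "`γ` preserves the property that … `η̈^{Θ,ℤ×μ₂}` … be of standard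
type".

PROOF-ONLY companion (no `def`, no instance, no new `Prop`; seat abc-iut-f-152, cell abc-iut blocks F/C;
SUPPORT for FACT-LIST rows F-0640/F-0642 at the model, not closing theorems) of
`Sec2ThetaOrbitTransportCalculus.lean` (generic calculus) and abc-iut-L2-t2's `ThetaRootOrbitsOfSetting.lean`
(the orbit data `ofEmbedding ε hC hS` along an `OrbitEmbedding ε`):
* generic complements: `transport_congr`, `innerAutTop_mul` (`γ_{xy} = γ_y ≫ γ_x`), the INVERSE LAW
  `EqUpToRootOfUnity.symm_transport` / `transport_symm_eq_self` (with the composition law: the pairs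
  `(Γ, Γ_Θ)` satisfying the conclusion shapes of Cor 2.8 (i)/(iii) are closed under composition and
  inversion), and `aug_toHat_congr_of_map_ker_le` / `…_symm_of_map_ker_eq` — a `Γ` mapping
  `Ker(Π^tp_C → G_K)` into (resp. onto) itself respects the `G_K`-fibres (resp. so does `Γ⁻¹`) — the
  hypothesis shape of `EqUpToRootOfUnity.transport`, automatic for inner `Γ`;
* `ofEmbedding_Dtau_finite` — `Dtau = {ι(D_τ ∩ Π^tp_{X̲̲}), ι(D_{τ⁻¹} ∩ Π^tp_{X̲̲})}` is finite;
* `ofEmbedding_deltaTheta_comm` — the cyclotome `ι(toTheta⁻¹Δ_Θ)/ι(Ker toTheta)` is COMMUTATIVE (a copy of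
  `Δ_Θ ≅ Ẑ(1)`), so `EqUpToRootOfUnity n H` is an equivalence relation there
  (`ofEmbedding_eqUpToRootOfUnity_trans`) and the composition law `EqUpToRootOfUnity.comp_transport` applies;
* `ofEmbedding_isStandardColl_transport` — **conjunct 1 of `Cor28_i` at `ofEmbedding` for EVERY `(Γ, Γ_Θ)`
  with `InducesOnTheta Γ Γ_Θ` and `Γ`-stable `Dtau`** (the inner case, where the transport is the identity,
  is abc-iut-L2-t2's `ofEmbedding_cor28_i_inner`).
HONEST FRAMING: [EtTh] is refereed; statements about the TYPED interface/model only; no side is taken on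
[IUTchIII] Cor 3.12; typed ≠ proved.
-/

noncomputable section

namespace Literature.AnabelianGeometry.EtaleTheta

open Literature.AnabelianGeometry.SemiGraphs ThetaCovers

universe u

namespace ThetaCovers.ThetaOrbitData

section generic

variable {l : ℕ} {T : TemperedCoverData.{u} l} (O : ThetaOrbitData T)

/-- A homeomorphic automorphism `Γ` of `Π^tp_C` mapping `Ker(Π^tp_C → G_K)` into itself respects the
`G_K`-fibres (the hypothesis shape used below; automatic for inner `Γ`). [cite: MochizukiEtTh2009, Cor 2.8(i) p.42] -/
theorem aug_toHat_congr_of_map_ker_le {Γ : T.Gtp ≃ₜ* T.Gtp}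
    (hΓ : (T.aug.comp T.toHat).ker.map Γ.toMulEquiv.toMonoidHom ≤ (T.aug.comp T.toHat).ker)
    (x y : T.Gtp) (hxy : T.aug (T.toHat x) = T.aug (T.toHat y)) :
    T.aug (T.toHat (Γ x)) = T.aug (T.toHat (Γ y)) := by
  have hk : x⁻¹ * y ∈ (T.aug.comp T.toHat).ker := by
    rw [MonoidHom.mem_ker, map_mul, map_inv, MonoidHom.comp_apply, MonoidHom.comp_apply, hxy,
      inv_mul_cancel]
  have hk' : Γ (x⁻¹ * y) ∈ (T.aug.comp T.toHat).ker := hΓ ⟨_, hk, rfl⟩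
  rw [map_mul, map_inv, MonoidHom.mem_ker, map_mul, map_inv, MonoidHom.comp_apply,
    MonoidHom.comp_apply] at hk'
  exact inv_mul_eq_one.1 hk'

/-- If `Γ` maps `Ker(Π^tp_C → G_K)` ONTO itself, then `Γ⁻¹` respects the `G_K`-fibres too.
[cite: MochizukiEtTh2009, Cor 2.8(i) p.42] -/
theorem aug_toHat_congr_symm_of_map_ker_eq {Γ : T.Gtp ≃ₜ* T.Gtp}
    (hΓ : (T.aug.comp T.toHat).ker.map Γ.toMulEquiv.toMonoidHom = (T.aug.comp T.toHat).ker)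
    (x y : T.Gtp) (hxy : T.aug (T.toHat x) = T.aug (T.toHat y)) :
    T.aug (T.toHat (Γ.symm x)) = T.aug (T.toHat (Γ.symm y)) :=
  aug_toHat_congr_of_map_ker_le (map_symm_eq _ hΓ).le x y hxy

/-- `transport` depends on `(Γ, Γ_Θ)` only (rewriting lemma for equal automorphisms, e.g.
`innerAutTop (x * y)` versus `(innerAutTop y).trans (innerAutTop x)`). [cite: MochizukiEtTh2009, Cor 2.8(i) p.42] -/
theorem transport_congr (H : Subgroup T.Gtp) {Γ Γ' : T.Gtp ≃ₜ* T.Gtp} (hΓ : Γ = Γ')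
    {ΓΘ ΓΘ' : O.DeltaTheta ≃* O.DeltaTheta} (hΘ : ΓΘ = ΓΘ')
    (h : H.map Γ.toMulEquiv.toMonoidHom = H) (h' : H.map Γ'.toMulEquiv.toMonoidHom = H)
    (C : Set (Set (↥H → O.DeltaTheta))) : O.transport H Γ h ΓΘ C = O.transport H Γ' h' ΓΘ' C := by
  subst hΓ hΘ
  rfl

/-- The inner automorphism of a product is the composite of the inner automorphisms:
`γ_{xy} = γ_y ≫ γ_x`. [cite: MochizukiEtTh2009, Cor 2.8(iii) p.42] -/
theorem innerAutTop_mul (x y : T.Gtp) :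
    (innerAutTop (x * y) : T.Gtp ≃ₜ* T.Gtp) = (innerAutTop y).trans (innerAutTop x) := by
  ext g
  show x * y * g * (x * y)⁻¹ = x * (y * g * y⁻¹) * x⁻¹
  group

variable {O}

/-- **INVERSE LAW** (commutative `Δ_Θ`): if `C` agrees with its transport along `(Γ, Γ_Θ)` up to a root of
unity of order `n` (`Γ_Θ` induced by `Γ`, `Γ⁻¹` respecting the `G_K`-fibres), then also along
`(Γ⁻¹, Γ_Θ⁻¹)` — with `EqUpToRootOfUnity.comp_transport` and `eqUpToRootOfUnity_refl` the pairs satisfying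
the conclusion shape of Cor 2.8 (i) are closed under composition and inversion.
[cite: MochizukiEtTh2009, Cor 2.8(i) p.42] -/
theorem EqUpToRootOfUnity.symm_transport (hcomm : ∀ a b : O.DeltaTheta, a * b = b * a) {n : ℕ}
    {H : Subgroup T.Gtp} {C : Set (Set (↥H → O.DeltaTheta))}
    {Γ : T.Gtp ≃ₜ* T.Gtp} {ΓΘ : O.DeltaTheta ≃* O.DeltaTheta} (hind : O.InducesOnTheta Γ ΓΘ)
    (hK' : ∀ x y : T.Gtp, T.aug (T.toHat x) = T.aug (T.toHat y) →
      T.aug (T.toHat (Γ.symm x)) = T.aug (T.toHat (Γ.symm y)))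
    (h : H.map Γ.toMulEquiv.toMonoidHom = H) (h' : H.map Γ.symm.toMulEquiv.toMonoidHom = H)
    (e : O.EqUpToRootOfUnity n H C (O.transport H Γ h ΓΘ C)) :
    O.EqUpToRootOfUnity n H C (O.transport H Γ.symm h' ΓΘ.symm C) := by
  have e' := e.transport hind.symm hK' h'
  rw [O.transport_symm_transport H Γ h h' ΓΘ C] at e'
  exact e'.symm' hcomm

/-- Exact preservation inverts: if `(Γ, Γ_Θ)` maps `C` onto itself, so does `(Γ⁻¹, Γ_Θ⁻¹)` (the shape of
Cor 2.8 (iii)). [cite: MochizukiEtTh2009, Cor 2.8(iii) p.42] -/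
theorem transport_symm_eq_self (H : Subgroup T.Gtp) {Γ : T.Gtp ≃ₜ* T.Gtp}
    (h : H.map Γ.toMulEquiv.toMonoidHom = H) (h' : H.map Γ.symm.toMulEquiv.toMonoidHom = H)
    {ΓΘ : O.DeltaTheta ≃* O.DeltaTheta} {C : Set (Set (↥H → O.DeltaTheta))}
    (e : O.transport H Γ h ΓΘ C = C) : O.transport H Γ.symm h' ΓΘ.symm C = C := by
  conv_lhs => rw [← e]
  exact O.transport_symm_transport H Γ h h' ΓΘ C

variable (O)

end generic

/-! ## At the §1 model `ThetaOrbitData.ofEmbedding` -/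

section model

variable {p : ℕ} [Fact p.Prime] {D : ThetaSetting p} {E : D.EtaleThetaData} {l : ℕ}
  {C : E.DoubleUnderline l} {T : TemperedCoverData.{u} l} (ε : C.OrbitEmbedding T)

/-- `Dtau = {ι(D_τ ∩ Π^tp_{X̲̲}), ι(D_{τ⁻¹} ∩ Π^tp_{X̲̲})}` is finite. [cite: MochizukiEtTh2009, Def 1.9 p.29] -/
theorem ofEmbedding_Dtau_finite (hC : D.Compat) (hS : D.Sec2Hyps) : (ofEmbedding ε hC hS).Dtau.Finite := by
  rw [ofEmbedding_Dtau]
  exact (Set.finite_singleton _).insert _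

/-- **The cyclotome of `ofEmbedding` is commutative**: `top/bot = ι(toTheta⁻¹Δ_Θ)/ι(Ker toTheta)` is a
copy of `Δ_Θ ≅ Ẑ(1)` (commutators of `toTheta⁻¹Δ_Θ` die in `(Π^tp_X)^Θ` since `Δ_Θ` is commutative, hence
lie in `Ker toTheta`). [cite: MochizukiEtTh2009, Def 2.7 p.41] -/
theorem ofEmbedding_deltaTheta_comm (hC : D.Compat) (hS : D.Sec2Hyps)
    (a b : (ofEmbedding ε hC hS).DeltaTheta) : a * b = b * a := by
  induction a using QuotientGroup.induction_on with
  | H t =>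
  induction b using QuotientGroup.induction_on with
  | H t' =>
  obtain ⟨g, hg, hgt⟩ :=
    Subgroup.mem_map.1 (show (t : T.Gtp) ∈ (D.DeltaTheta.comap D.toTheta).map ε.ι from t.2)
  obtain ⟨g', hg', hgt'⟩ :=
    Subgroup.mem_map.1 (show (t' : T.Gtp) ∈ (D.DeltaTheta.comap D.toTheta).map ε.ι from t'.2)
  rw [← QuotientGroup.mk_mul, ← QuotientGroup.mk_mul, QuotientGroup.eq, Subgroup.mem_subgroupOf]
  show ((t * t')⁻¹ * (t' * t) : ↥(ofEmbedding ε hC hS).top).1 ∈ D.toTheta.ker.map ε.ι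
  refine ⟨(g * g')⁻¹ * (g' * g), ?_, ?_⟩
  · have hc : D.toTheta g * D.toTheta g' = D.toTheta g' * D.toTheta g :=
      congrArg Subtype.val (IsMulCommutative.is_comm.comm (⟨_, hg⟩ : ↥D.DeltaTheta) ⟨_, hg'⟩)
    rw [SetLike.mem_coe, MonoidHom.mem_ker, map_mul, map_inv, map_mul, map_mul, hc, inv_mul_cancel]
  · simp only [map_mul, map_inv, hgt, hgt']
    rfl

/-- **Cor 2.8 (i), conjunct 1, at `ofEmbedding`, for EVERY `(Γ, Γ_Θ)` with `InducesOnTheta`** (not only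
the inner ones of `Sec2Cor28iInnerOfEmbedding`): if `η̈^{Θ,ℤ×μ₂}` is of standard type and `Γ` permutes
`Dtau`, its transport along `(Γ, Γ_Θ)` is of standard type. [cite: MochizukiEtTh2009, Cor 2.8(i) p.42] -/
theorem ofEmbedding_isStandardColl_transport (hC : D.Compat) (hS : D.Sec2Hyps)
    (hstd : (ofEmbedding ε hC hS).IsStandard) {Γ : T.Gtp ≃ₜ* T.Gtp}
    {ΓΘ : (ofEmbedding ε hC hS).DeltaTheta ≃* (ofEmbedding ε hC hS).DeltaTheta}
    (hind : (ofEmbedding ε hC hS).InducesOnTheta Γ ΓΘ)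
    (hD : ∀ D ∈ (ofEmbedding ε hC hS).Dtau, D.map Γ.toMulEquiv.toMonoidHom ∈ (ofEmbedding ε hC hS).Dtau)
    (hY : T.PiYddtp.map Γ.toMulEquiv.toMonoidHom = T.PiYddtp) :
    (ofEmbedding ε hC hS).IsStandardColl
      ((ofEmbedding ε hC hS).transport _ Γ hY ΓΘ (ofEmbedding ε hC hS).etaZMu2) :=
  (ofEmbedding ε hC hS).isStandardColl_transport_etaZMu2 (ofEmbedding_Dtau_finite ε hC hS) hstd hind hD hY

/-- At `ofEmbedding`, "equal up to a root of unity of order `n`" is SYMMETRIC and TRANSITIVE and monotone in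
`n` (commutative cyclotome), and obeys the composition law `EqUpToRootOfUnity.comp_transport` — recorded as
the transitivity instance. [cite: MochizukiEtTh2009, Cor 2.8(i) p.42] -/
theorem ofEmbedding_eqUpToRootOfUnity_trans (hC : D.Compat) (hS : D.Sec2Hyps) {n : ℕ}
    {H : Subgroup T.Gtp} {C₁ C₂ C₃ : Set (Set (↥H → (ofEmbedding ε hC hS).DeltaTheta))}
    (h₁ : (ofEmbedding ε hC hS).EqUpToRootOfUnity n H C₁ C₂)
    (h₂ : (ofEmbedding ε hC hS).EqUpToRootOfUnity n H C₂ C₃) :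
    (ofEmbedding ε hC hS).EqUpToRootOfUnity n H C₁ C₃ ∧ (ofEmbedding ε hC hS).EqUpToRootOfUnity n H C₂ C₁ :=
  ⟨h₁.trans' (ofEmbedding_deltaTheta_comm ε hC hS) h₂, h₁.symm' (ofEmbedding_deltaTheta_comm ε hC hS)⟩

end model

end ThetaCovers.ThetaOrbitData

end Literature.AnabelianGeometry.EtaleTheta

end
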